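import Summits.MatrixMultiplication.MatrixMultiplication.Theorems.FarEdgeDescentImprovableRate
import HarnessLib

/-!
# Far-edge descent, kernel XXXVIII-0: analysis of the ANCHOR-BUDGET DIAL (exponent `κ_a`, order `θ_a`)

Route `FarEdgeDescent`, special leaf `FiniteSaturation` (stmt-MatrixMultiplication-23739): helper
kernel, THESES-FREE and def-free (decomp-mm lens 2 «structural dichotomy: special vs generic», gen 58).

The product-and-full-reanchor calculus with ANCHOR BUDGET FACTOR `β` (an anchored object `⟨1,Q,1⟩ ⊕ legs`
costs `r = Q + βL`; re-anchored product `Q'' = QQ' + β(β−1)LL'`, `λ'' = λ + λ' − (2β−1)λλ'`, fixed point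
`1/(2β−1)`, deviation multiplier `2β/(2β−1)`; `β = 2` is the free-lunch toolbox of kernels XXX–XXXVII,
Knuth 4.6.4 Ex. 67(g), Alman–Li 2026 Thm. 5.1) becomes, in the coordinates `u = (2β−1)λ/3`,
`a = 3(β−1)/(2β−1) ∈ (0,1]` (`dial_of_budget`), the `a`-DIAL of kernels XXXVIII-A/B: share dynamics
`u'' = u+u'−3uu'` (unchanged), normal form `F = 1 − au + X`, cross coefficient `a(3−a)`, exponent

  `κ_a = log₂(2(3−a)/3) = log₂(2β/(2β−1))`,  `p_a = 1/(1−κ_a)`,  `(1 − a/3)^{p_a} = 1/2`,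
  `θ_a = κ_a/(1−κ_a) = log(2β/(2β−1))/log((2β−1)/β)`.

This file is the real analysis of the dial: `dialKappa_pos_lt_one` (`0 < κ_a < 1` for every `a ∈ (0,3/2)`:
NO budget factor `β > 1` reaches the linear exponent), `one_sub_dialKappa`, `dial_magic`, `dial_of_budget`,
`dialKappa_anti` (cheaper anchors ⟹ larger exponent), `dialTheta_ge` (`θ_a ≥ 2log(4/3)/a`),
`dialTheta_unbounded` (every polynomial order is reached as `β → 1⁺`).  Values: `θ_2 = 0.7095 = θ_S`,
`θ_{7/4} = 0.943`, `θ_{3/2} = 1.41`, `θ_{5/4} = 2.80`.  The ceiling theorem using them is kernel XXXVIII-B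
(`FarEdgeDescentDialCeiling.dial_ceiling`).

References: Schönhage 1981, §5; Pan 1984 (LNCS 179) §17; Knuth TAOCP 2 §4.6.4 Ex. 67(g),(h);
Alman–Li 2026, Thm. 5.1, Prop. 5.3.
Tags: `FiniteSaturation` (h₁) NEC · WEAKER · ATTACKED; support (analysis) for the dial ceiling.
-/

set_option linter.dupNamespace false

noncomputable section

namespace Summit.MatrixMultiplication.MatrixMultiplication.Theorems.FarEdgeDescentDialAnalysis

/-! ## §0 Dial analysis: the exponent `κ_a = log₂(2(3−a)/3)` and the order `θ_a = κ_a/(1−κ_a)` -/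

/-- `0 < κ_a < 1` for `0 < a < 3/2`, `κ_a = log₂(2(3−a)/3)` (`1 < 2(3−a)/3 < 2`).  In budget terms
(`a = 3(β−1)/(2β−1)`): the deviation multiplier `2β/(2β−1)` of every toolbox with `β > 1` lies strictly
between `1` and `2` — the exponent never reaches the linear value `1`. [folklore] -/
theorem dialKappa_pos_lt_one {a : ℝ} (ha0 : 0 < a) (ha : a < 3 / 2) :
    0 < Real.logb 2 (2 * (3 - a) / 3) ∧ Real.logb 2 (2 * (3 - a) / 3) < 1 := by
  have h1 : 1 < 2 * (3 - a) / 3 := by linarith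
  have h2 : 2 * (3 - a) / 3 < 2 := by linarith
  refine ⟨Real.logb_pos (by norm_num) h1, ?_⟩
  have h := Real.logb_lt_logb (b := 2) (by norm_num) (by linarith : (0 : ℝ) < 2 * (3 - a) / 3) h2
  rwa [Real.logb_self_eq_one (by norm_num)] at h

/-- `1 − κ_a = log(3/(3−a))/log 2` (`a < 3`); `a = 1`: `log(3/2)/log 2` (XXXVI-A `one_sub_kappa`). [folklore] -/
theorem one_sub_dialKappa {a : ℝ} (ha : a < 3) :
    1 - Real.logb 2 (2 * (3 - a) / 3) = Real.log (3 / (3 - a)) / Real.log 2 := by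
  have h2 : Real.log (2 : ℝ) ≠ 0 := ne_of_gt (Real.log_pos (by norm_num))
  have h3a : (3 : ℝ) - a ≠ 0 := by intro h; linarith
  have hq : (3 : ℝ) / (3 - a) = 2 / (2 * (3 - a) / 3) := by field_simp
  have h : Real.log (3 / (3 - a)) = Real.log 2 - Real.log (2 * (3 - a) / 3) := by
    rw [hq, Real.log_div (by norm_num)]
    exact div_ne_zero (mul_ne_zero (by norm_num) h3a) (by norm_num)
  rw [Real.logb, h]
  field_simp

/-- **The dial magic identity** `(1 − a/3)^{1/(1−κ_a)} = 1/2` (`0 < a < 3`): at the fixed share `u = 1/3`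
the squaring step of the `a`-dial (mass factor `1 − a/3` per doubled log-rank, deviation multiplier
`2^{κ_a} = 2(3−a)/3`) is the equality case of the leg-mass tax; `a = 1` is `(2/3)^{log 2/log(3/2)} = 1/2`
(XXXVI-A `twoThirds_rpow_conj`). [folklore] -/
theorem dial_magic {a : ℝ} (ha0 : 0 < a) (ha : a < 3) :
    (1 - a / 3) ^ (1 / (1 - Real.logb 2 (2 * (3 - a) / 3))) = 1 / 2 := by
  rw [one_sub_dialKappa ha, one_div_div]
  have h3a : 0 < 3 - a := by linarith
  have h3ne : (3 : ℝ) - a ≠ 0 := h3a.ne'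
  have hpos : 0 < 1 - a / 3 := by linarith
  rw [Real.rpow_def_of_pos hpos]
  have hinv : (1 : ℝ) - a / 3 = (3 / (3 - a))⁻¹ := by
    rw [inv_div, eq_div_iff (by norm_num : (3 : ℝ) ≠ 0)]
    ring
  have hq : Real.log (1 - a / 3) = -Real.log (3 / (3 - a)) := by rw [hinv, Real.log_inv]
  have hne : Real.log (3 / (3 - a)) ≠ 0 := by
    apply ne_of_gt
    apply Real.log_pos
    rw [lt_div_iff₀ h3a]
    linarith
  have e : Real.log (1 - a / 3) * (Real.log 2 / Real.log (3 / (3 - a))) = -Real.log 2 := by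
    rw [hq]
    field_simp
  rw [e, Real.exp_neg, Real.exp_log (by norm_num)]
  norm_num

/-- **Budget ↦ dial dictionary.**  For an anchor budget factor `β ∈ (1,2]` put `a = 3(β−1)/(2β−1)`:
then `0 < a ≤ 1`, the deviation multiplier is `2(3−a)/3 = 2β/(2β−1)` and the cross coefficient is
`a(3−a) = 9β(β−1)/(2β−1)²` (`= β(β−1)·(3/(2β−1))²`, the image of `β(β−1)λλ'` under `u = (2β−1)λ/3`);
`β = 2 ↦ a = 1` (the free-lunch toolbox of kernels XXX–XXXVII). [cite: AlmanLi2026, Thm. 5.1, Prop. 5.3]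
[cite: KnuthTAOCP2, §4.6.4 Ex. 67] -/
theorem dial_of_budget {β : ℝ} (hβ : 1 < β) (hβ2 : β ≤ 2) :
    0 < 3 * (β - 1) / (2 * β - 1) ∧ 3 * (β - 1) / (2 * β - 1) ≤ 1 ∧
      2 * (3 - 3 * (β - 1) / (2 * β - 1)) / 3 = 2 * β / (2 * β - 1) ∧
      3 * (β - 1) / (2 * β - 1) * (3 - 3 * (β - 1) / (2 * β - 1)) =
        9 * β * (β - 1) / (2 * β - 1) ^ 2 := by
  have h : 0 < 2 * β - 1 := by linarith
  have hne : 2 * β - 1 ≠ 0 := h.ne'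
  have e : 3 - 3 * (β - 1) / (2 * β - 1) = 3 * β / (2 * β - 1) := by
    rw [eq_div_iff hne, sub_mul, div_mul_cancel₀ _ hne]
    ring
  refine ⟨div_pos (by linarith) h, ?_, ?_, ?_⟩
  · rw [div_le_one h]; linarith
  · rw [e]
    ring
  · rw [e, div_mul_div_comm, pow_two]
    ring

/-- **Cheaper anchors ⟹ larger exponent.**  `κ_a` is strictly decreasing in `a ∈ (−∞, 3)`: lowering the
budget factor `β` (so `a`) raises the certified exponent — the dial is monotone. [folklore] -/
theorem dialKappa_anti {a a' : ℝ} (haa' : a < a') (ha' : a' < 3) :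
    Real.logb 2 (2 * (3 - a') / 3) < Real.logb 2 (2 * (3 - a) / 3) :=
  Real.logb_lt_logb (by norm_num) (by linarith) (by linarith)

/-- **The order of the dial blows up at the special endpoint**: `θ_a = κ_a/(1−κ_a) ≥ 2log(4/3)/a` for
`0 < a ≤ 1` (`κ_a ≥ log₂(4/3)` and `1 − κ_a = log₂(3/(3−a)) ≤ a/((3−a)log 2) ≤ a/(2 log 2)`).  In budget
terms `θ ≥ (2log(4/3)/3)·(2β−1)/(β−1)`: arbitrarily large orders as `β → 1⁺`, never the linear wedge.
[folklore] -/
theorem dialTheta_ge {a : ℝ} (ha0 : 0 < a) (ha1 : a ≤ 1) :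
    2 * Real.log (4 / 3) / a ≤
      Real.logb 2 (2 * (3 - a) / 3) / (1 - Real.logb 2 (2 * (3 - a) / 3)) := by
  obtain ⟨hκ0, hκ1⟩ := dialKappa_pos_lt_one ha0 (by linarith)
  set κ : ℝ := Real.logb 2 (2 * (3 - a) / 3) with hκ
  have h1κ : 0 < 1 - κ := by linarith
  have hlog2 : 0 < Real.log 2 := Real.log_pos (by norm_num)
  have h3a : 0 < 3 - a := by linarith
  -- 1 − κ ≤ a/(2 log 2)
  have h1 : (1 - κ) * Real.log 2 ≤ a / 2 := by
    have e : (1 - κ) * Real.log 2 = Real.log (3 / (3 - a)) := by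
      rw [hκ, one_sub_dialKappa (by linarith), div_mul_cancel₀ _ hlog2.ne']
    have hl : Real.log (3 / (3 - a)) ≤ 3 / (3 - a) - 1 := Real.log_le_sub_one_of_pos (by positivity)
    have hq : (3 : ℝ) / (3 - a) - 1 = a / (3 - a) := by field_simp; ring
    have hq2 : a / (3 - a) ≤ a / 2 := div_le_div_of_nonneg_left ha0.le (by norm_num) (by linarith)
    linarith
  -- log(4/3) ≤ κ log 2
  have h2 : Real.log (4 / 3) ≤ κ * Real.log 2 := by
    have hk : Real.logb 2 ((4 : ℝ) / 3) ≤ κ := by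
      rw [hκ]
      exact Real.logb_le_logb_of_le (by norm_num) (by norm_num) (by linarith)
    have e : Real.logb 2 ((4 : ℝ) / 3) * Real.log 2 = Real.log (4 / 3) := by
      rw [Real.logb, div_mul_cancel₀ _ hlog2.ne']
    nlinarith [mul_le_mul_of_nonneg_right hk hlog2.le]
  rw [div_le_div_iff₀ ha0 h1κ]
  have h3 : 2 * Real.log (4 / 3) * (1 - κ) ≤ 2 * (κ * Real.log 2) * (1 - κ) :=
    mul_le_mul_of_nonneg_right (by linarith) h1κ.le
  have h4 : 2 * (κ * Real.log 2) * (1 - κ) = κ * (2 * ((1 - κ) * Real.log 2)) := by ring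
  have h5 : κ * (2 * ((1 - κ) * Real.log 2)) ≤ κ * a :=
    mul_le_mul_of_nonneg_left (by linarith) hκ0.le
  linarith

/-- **The dial has no ceiling short of `β = 1`**: for every `Θ` there is `a ∈ (0,1]` with `θ_a > Θ`.
Together with `dialKappa_pos_lt_one` (`κ_a < 1` always): the anchor-budget family certifies every
POLYNOMIAL rate order and never the saturation-grade linear wedge. [folklore] -/
theorem dialTheta_unbounded (Θ : ℝ) : ∃ a : ℝ, 0 < a ∧ a ≤ 1 ∧
    Θ < Real.logb 2 (2 * (3 - a) / 3) / (1 - Real.logb 2 (2 * (3 - a) / 3)) := by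
  have hL : 0 < 2 * Real.log (4 / 3 : ℝ) := by
    have := Real.log_pos (by norm_num : (1 : ℝ) < 4 / 3); linarith
  have hΘ : 0 < |Θ| + 1 := by positivity
  obtain ⟨a, ha⟩ : ∃ a : ℝ, a = min 1 (2 * Real.log (4 / 3) / (|Θ| + 1)) := ⟨_, rfl⟩
  have ha0 : 0 < a := by rw [ha]; exact lt_min one_pos (div_pos hL hΘ)
  have ha1 : a ≤ 1 := by rw [ha]; exact min_le_left _ _
  have ha2 : a ≤ 2 * Real.log (4 / 3) / (|Θ| + 1) := by rw [ha]; exact min_le_right _ _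
  refine ⟨a, ha0, ha1, lt_of_lt_of_le ?_ (dialTheta_ge ha0 ha1)⟩
  have h1 : |Θ| + 1 ≤ 2 * Real.log (4 / 3) / a := by
    rw [le_div_iff₀ ha0]
    calc (|Θ| + 1) * a ≤ (|Θ| + 1) * (2 * Real.log (4 / 3) / (|Θ| + 1)) :=
          mul_le_mul_of_nonneg_left ha2 hΘ.le
      _ = 2 * Real.log (4 / 3) := by field_simp
  linarith [le_abs_self Θ]

end Summit.MatrixMultiplication.MatrixMultiplication.Theorems.FarEdgeDescentDialAnalysis

end
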